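import Summits.HodgeConjecture.HodgeConjecture.Cruxes.BlochSeedDiscOne.DiamondLevelLaws

/-!
# The SUB-DIAMOND RESTRICTION `◇_h ⊂ ◇_{h'}` and the DOWNWARD HALF of the partner-restriction law (KERNEL, every `h ≤ h'`)

control g19 (planner ideator, LENSES-v3 «control», director-hodge req-36; unit `plan-lens-HodgeAV-control-g19`).  Typed companion of
memo `Cruxes/BlochSeedDiscOne/KSPAN-PEEL-g19.md` (v1.2, sha16 9667342069846c60) §10–§11, LAW 1 («partner restriction»): in the census's
static third-code theory, a certificate clause of a DOWNWARD rule family (RULE D at an `N`-cell, `A2I⁻`) for a head inside `◇_h` is VERBATIM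
the same clause in `◇_{h+2}` (machine, exact: DN 9 557 + 932, Am 1 161 + 216 clauses at `◇₆ → ◇₈`, `◇₄ → ◇₆`; 0 exceptions), while the
UPWARD families (RULE D at a `P`-cell, `X⁺`) acquire extra partners, all touching or crossing level `h`.  This file proves the configuration-
level content of the downward half, for EVERY pair `h ≤ h'` (no census input):

* `diamondRestrict h C` — the cells of `C` all four of whose letters lie in `◇_h` (the analogue of `DiamondLevelLaws.lineRestrict`);
  it lies in `◇_h`, equals `C` when `C ⊂ ◇_h`, and is `G₁`-closed when `C` is (`diamondRestrict_g1Closed`);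
* `inDiamond_of_ray_below`, `inDiamond_of_effective_below` — a letter of `◇_{h'}` null- or causally-below a letter of `◇_h` lies in `◇_h`
  (causal top is monotone: `DiamondLevelLaws.causalTop_ray_ge` and an axis-letter version of `onCeiling_of_effective_above`);
* **`ruleDMu4N_diamondRestrict`** — RULE D at every `N`-cell of the restriction holds in the restriction if it held in `C`
  (its witnesses — service below, covers below — are causally dominated by the head);
* `upperRestrict t C` (§6, the mirror: cells with all node levels `≥ t`, i.e. for `t = 2` the `+2I`-copy of `◇_h` inside `◇_{h+2}`),
  `nodeLevel_ray_ge`, **`ruleDMu4P_upperRestrict`** — RULE D at `P`-cells restricts verbatim UPWARD (the `DP` half of LAW 1 under map C);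
* `nodeLevel_le_of_effective`, **`xPlusClosed_upperRestrict`** (§7: `X⁺` restricts verbatim upward — the `Xp` half under map C; the dual of
  `xPlusClosed_lineRestrict` with «ceiling» replaced by «node ≥ t»), `upwardLaws_upperRestrict`;
* **`a2iMinusClosed_diamondRestrict`** — `A2I⁻`-closedness passes from `C ⊂ ◇_{h'}` to `diamondRestrict h C` (participants of a firing
  clause in the restriction are in `C`; every escape ∕ polluter the clause quantifies over is causally dominated by the participants
  `Z, q, N′`, hence lies in `◇_h` and is quantified over in the restriction too).

NOT claimed, and FALSE as configuration statements in general: the same for RULE D at `P`-cells and for `X⁺` (their witnesses lie ABOVE the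
head and may leave `◇_h` — exactly the «extra partners touching or crossing level h» of LAW 1); hence NO statement `StaticH1 C →
StaticH1 (diamondRestrict h C)` is made.  HC ∕ HC_CM ∕ HC_AV ∕ H2 = `stmt-HodgeConjecture-18881` ∕ (T_h) ∕ KAbsent_h are NOT proved here or
by the memo; nothing here is evidence for or against HC.  0 `sorry`, no `instance`, no notation, axioms standard.
-/

set_option linter.dupNamespace false

namespace Summit.HodgeConjecture.HodgeConjecture.Cruxes.BlochSeedDiscOne.DiamondRestrict

open Finset Summit.Ventures.HSemireg.Pad4Tower
open Summit.HodgeConjecture.HodgeConjecture.Cruxes.BlochSeedDiscOne.DiamondLevelLaws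

/-! ## §1 Causal domination keeps letters inside `◇_h` -/

/-- a valid letter (of some `◇_{h'}`) NULL-BELOW-OR-EQUAL a letter of `◇_h` lies in `◇_h` (`causalTop_ray_ge`). -/
theorem inDiamond_of_ray_below {h h' : ℤ} {x y : BPoint} (hy : InDiamond h y) (hx : InDiamond h' x) (k : Fin 4) {e : ℤ}
    (he : 0 ≤ e) (hyx : y = ray x k e) : InDiamond h x := by
  have h1 := causalTop_ray_ge x k he
  rw [← hyx] at h1
  exact ⟨hx.1, hx.2.1, hx.2.2.1, by have := hy.2.2.2; omega⟩

/-- **causal top is monotone along effective (future-causal) differences of μ₄ letters.** -/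
theorem causalTop_le_of_effective {x y : BPoint} (hxax : x.2 = (0, 0) ∨ AxisPt x) (hyax : y.2 = (0, 0) ∨ AxisPt y)
    (hE : Effective (bsub y x)) : x.1 + absCharge x ≤ y.1 + absCharge y := by
  obtain ⟨α, a, b⟩ := x
  obtain ⟨α', a', b'⟩ := y
  simp only [absCharge, chargeOf, AxisPt, Effective, Prod.mk.injEq] at *
  obtain ⟨hD, hsq⟩ := hE
  have h1 : a' - a ≤ α' - α := by nlinarith [sq_nonneg (b' - b), sq_nonneg (a' - a)]
  have h2 : -(a' - a) ≤ α' - α := by nlinarith [sq_nonneg (b' - b), sq_nonneg (a' - a)]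
  have h3 : b' - b ≤ α' - α := by nlinarith [sq_nonneg (b' - b), sq_nonneg (a' - a)]
  have h4 : -(b' - b) ≤ α' - α := by nlinarith [sq_nonneg (b' - b), sq_nonneg (a' - a)]
  simp only [abs_eq_max_neg, max_def] at *
  split_ifs at * <;> omega

/-- a valid letter CAUSALLY BELOW a letter of `◇_h` lies in `◇_h`. -/
theorem inDiamond_of_effective_below {h h' : ℤ} {x y : BPoint} (hy : InDiamond h y) (hx : InDiamond h' x)
    (hE : Effective (bsub y x)) : InDiamond h x :=
  ⟨hx.1, hx.2.1, hx.2.2.1, by have := causalTop_le_of_effective hx.1 hy.1 hE; have := hy.2.2.2; omega⟩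

/-- strictly null-below is causally below. -/
theorem effective_of_nullBelow {x y : BPoint} (h : NullBelow y x) : Effective (bsub x y) := by
  obtain ⟨h1, h2⟩ := h
  refine ⟨by show 0 ≤ x.1 - y.1; omega, ?_⟩
  show (x.2.1 - y.2.1) ^ 2 + (x.2.2 - y.2.2) ^ 2 ≤ (x.1 - y.1) ^ 2
  rw [h2]

theorem inDiamond_of_nullBelow {h h' : ℤ} {x y : BPoint} (hy : InDiamond h y) (hx : InDiamond h' x) (hnb : NullBelow x y) :
    InDiamond h x :=
  inDiamond_of_effective_below hy hx (effective_of_nullBelow hnb)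

/-- a cell agreeing with a `◇_h`-cell off one factor and ray-below it there lies in `◇_h` (e.g. a `U`-partner BELOW: `UPartner Z P σ k`). -/
theorem inDiamond_cell_of_uPartner_below {h h' : ℤ} {Z P : MCell} (hZ : MCell.InDiamond h Z) (hP : MCell.InDiamond h' P)
    {σ k : Fin 4} (hZP : UPartner Z P σ k) : MCell.InDiamond h P := by
  intro f
  by_cases hf : f = σ
  · subst hf
    exact inDiamond_of_ray_below (hZ f) (hP f) k (by have := hZP.2.1; omega) hZP.2.2
  · rw [hZP.1 f hf]; exact hZ f

/-! ## §2 The sub-diamond restriction -/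

/-- **the SUB-DIAMOND RESTRICTION**: the cells of `C` lying in `◇_h` (all four letters). -/
def diamondRestrict (h : ℤ) (C : MConfig) : MConfig :=
  ⟨C.lower.filter (fun Z => ∀ f, InDiamond h (Z f)), C.upper.filter (fun Z => ∀ f, InDiamond h (Z f))⟩

theorem mem_diamondRestrict_lower {h : ℤ} {C : MConfig} {Z : MCell} :
    Z ∈ (diamondRestrict h C).lower ↔ Z ∈ C.lower ∧ ∀ f, InDiamond h (Z f) := Finset.mem_filter

theorem mem_diamondRestrict_upper {h : ℤ} {C : MConfig} {Z : MCell} :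
    Z ∈ (diamondRestrict h C).upper ↔ Z ∈ C.upper ∧ ∀ f, InDiamond h (Z f) := Finset.mem_filter

/-- the restriction lies in `◇_h` (by definition; no hypothesis on `C`). -/
theorem diamondRestrict_inDiamond (h : ℤ) (C : MConfig) : (diamondRestrict h C).InDiamond h :=
  ⟨fun _ hZ => (mem_diamondRestrict_lower.1 hZ).2, fun _ hP => (mem_diamondRestrict_upper.1 hP).2⟩

/-- … and in every `◇_{h'}` containing `C`. -/
theorem diamondRestrict_inDiamond' {h h' : ℤ} {C : MConfig} (hU : C.InDiamond h') : (diamondRestrict h C).InDiamond h' :=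
  ⟨fun Z hZ => hU.1 Z (mem_diamondRestrict_lower.1 hZ).1, fun P hP => hU.2 P (mem_diamondRestrict_upper.1 hP).1⟩

/-- a configuration already in `◇_h` is its own restriction. -/
theorem diamondRestrict_eq_self {h : ℤ} {C : MConfig} (hU : C.InDiamond h) : diamondRestrict h C = C := by
  obtain ⟨lo, up⟩ := C
  simp only [diamondRestrict, MConfig.mk.injEq]
  exact ⟨Finset.filter_true_of_mem fun Z hZ => hU.1 Z hZ, Finset.filter_true_of_mem fun P hP => hU.2 P hP⟩

/-- restriction is idempotent and nested restrictions compose to the smaller height. -/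
theorem diamondRestrict_idem (h : ℤ) (C : MConfig) : diamondRestrict h (diamondRestrict h C) = diamondRestrict h C :=
  diamondRestrict_eq_self (diamondRestrict_inDiamond h C)

/-- `Δ` keeps the diamond predicate (proved here letter-wise to keep the imports at `DiamondLevelLaws`). -/
theorem inDiamond_deltaPt {h : ℤ} {x : BPoint} : InDiamond h (deltaPt x) ↔ InDiamond h x := by
  obtain ⟨a, b, c⟩ := x
  by_cases hb : b = 0
  · subst hb
    by_cases hc : c = 0
    · subst hc; simp [InDiamond, AxisPt, absCharge, chargeOf, deltaPt]
    · simp [InDiamond, AxisPt, absCharge, chargeOf, deltaPt, hc, abs_neg]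
  · by_cases hc : c = 0
    · subst hc; simp [InDiamond, AxisPt, absCharge, chargeOf, deltaPt, hb, abs_neg]
    · simp [InDiamond, AxisPt, absCharge, chargeOf, deltaPt, hb, hc]

/-- **the restriction of a `G₁`-closed configuration is `G₁`-closed** (factor permutations permute the letters; `Δ` keeps `◇_h`). -/
theorem diamondRestrict_g1Closed {h : ℤ} {C : MConfig} (hG : C.G1Closed) : (diamondRestrict h C).G1Closed := by
  obtain ⟨hPl, hPu, hDl, hDu⟩ := hG
  refine ⟨fun σ Z hZ => ?_, fun σ P hP => ?_, fun Z hZ => ?_, fun P hP => ?_⟩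
  · obtain ⟨hZC, hc⟩ := mem_diamondRestrict_lower.1 hZ
    exact mem_diamondRestrict_lower.2 ⟨hPl σ Z hZC, fun f => hc (σ f)⟩
  · obtain ⟨hPC, hc⟩ := mem_diamondRestrict_upper.1 hP
    exact mem_diamondRestrict_upper.2 ⟨hPu σ P hPC, fun f => hc (σ f)⟩
  · obtain ⟨hZC, hc⟩ := mem_diamondRestrict_lower.1 hZ
    exact mem_diamondRestrict_lower.2 ⟨hDl Z hZC, fun f => inDiamond_deltaPt.2 (hc f)⟩
  · obtain ⟨hPC, hc⟩ := mem_diamondRestrict_upper.1 hP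
    exact mem_diamondRestrict_upper.2 ⟨hDu P hPC, fun f => inDiamond_deltaPt.2 (hc f)⟩

/-! ## §3 RULE D at `N`-cells restricts verbatim (the `DN` half of LAW 1) -/

/-- **RULE D at an `N`-cell of `◇_h` survives the restriction** (KERNEL, every `h ≤ h'`… in fact every `h, h'`): its servers and covers
below are causally dominated by the head, letter by letter. -/
theorem ruleDMu4N_diamondRestrict {h h' : ℤ} {C : MConfig} (hU : C.InDiamond h') {Z : MCell} (hZ : MCell.InDiamond h Z)
    (hD : RuleDMu4N C Z) : RuleDMu4N (diamondRestrict h C) Z := by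
  intro g j hgj k k' hk hk' hne
  have settle : ∀ (f r : Fin 4), MServedBelow C Z f r → MServedBelow (diamondRestrict h C) Z f r := by
    rintro f r ⟨P, hP, hZP⟩
    exact ⟨P, mem_diamondRestrict_upper.2 ⟨hP, inDiamond_cell_of_uPartner_below hZ (hU.2 P hP) hZP⟩, hZP⟩
  rcases hD g j hgj k k' hk hk' hne with ⟨r, hr, hs⟩ | ⟨r, hr, hs⟩ | ⟨a, b, ha, hb, P, hP, hag, hg1, hg2, hj1, hj2⟩
  · exact Or.inl ⟨r, hr, settle g r hs⟩
  · exact Or.inr (Or.inl ⟨r, hr, settle j r hs⟩)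
  · refine Or.inr (Or.inr ⟨a, b, ha, hb, P, mem_diamondRestrict_upper.2 ⟨hP, fun f => ?_⟩, hag, hg1, hg2, hj1, hj2⟩)
    by_cases hfg : f = g
    · subst hfg; exact inDiamond_of_ray_below (hZ f) (hU.2 P hP f) a (by omega) hg2
    by_cases hfj : f = j
    · subst hfj; exact inDiamond_of_ray_below (hZ f) (hU.2 P hP f) b (by omega) hj2
    · rw [hag f hfg hfj]; exact hZ f

/-- hence the `N`-half of RULE-D closure of the restriction is a THEOREM. -/
theorem ruleDMu4N_diamondRestrict_all {h h' : ℤ} {C : MConfig} (hU : C.InDiamond h') (hD : RuleDMu4Closed C) :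
    ∀ Z ∈ (diamondRestrict h C).lower, RuleDMu4N (diamondRestrict h C) Z := fun Z hZ =>
  ruleDMu4N_diamondRestrict hU (mem_diamondRestrict_lower.1 hZ).2 (hD.1 Z (mem_diamondRestrict_lower.1 hZ).1)

/-! ## §4 `A2I⁻` restricts verbatim (the `Am` half of LAW 1) -/

/-- **`A2I⁻`-closedness passes to the restriction** (KERNEL, every `h, h'`): a clause firing in the restriction would fire in `C` — its
participants are cells of `C`, and each escape ∕ polluter cell that `C` could offer in addition has all its letters causally below letters of
the participants `Z`, `q`, `N′`, hence lies in `◇_h`, i.e. was already quantified over in the restriction. -/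
theorem a2iMinusClosed_diamondRestrict {h h' : ℤ} {C : MConfig} (hU : C.InDiamond h') (hA : A2IMinusClosed C) :
    A2IMinusClosed (diamondRestrict h C) := by
  intro Z hZ q hq N' hN' σ u f' v hF
  obtain ⟨hZC, hZd⟩ := mem_diamondRestrict_lower.1 hZ
  obtain ⟨hqC, hqd⟩ := mem_diamondRestrict_upper.1 hq
  obtain ⟨hN'C, hN'd⟩ := mem_diamondRestrict_lower.1 hN'
  obtain ⟨c1, c2, c3, c4, c5, c6, c7, c8, c9, c10, c11⟩ := hF
  refine hA Z hZC q hqC N' hN'C σ u f' v ⟨c1, c2, c3, c4, c5, c6, ?_, ?_, ?_, ?_, ?_⟩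
  · -- no partner of `Z` on `σ` in another direction: such a partner is below `Z`
    intro P hP w hw hZP
    exact c7 P (mem_diamondRestrict_upper.2 ⟨hP, inDiamond_cell_of_uPartner_below hZd (hU.2 P hP) hZP⟩) w hw hZP
  · -- `q` topmost among the `u`-partners of `Z`
    intro P hP hZP
    exact c8 P (mem_diamondRestrict_upper.2 ⟨hP, inDiamond_cell_of_uPartner_below hZd (hU.2 P hP) hZP⟩) hZP
  · -- nothing on the `u`-line strictly below `q`
    intro P hP hqP
    exact c9 P (mem_diamondRestrict_upper.2 ⟨hP, inDiamond_cell_of_uPartner_below hqd (hU.2 P hP) hqP⟩) hqP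
  · -- (A1W) below-partners of `Z` on `f'`
    intro P hP hnb hag
    refine c10 P (mem_diamondRestrict_upper.2 ⟨hP, fun g => ?_⟩) hnb hag
    by_cases hgf : g = f'
    · subst hgf; exact inDiamond_of_nullBelow (hZd g) (hU.2 P hP g) hnb
    rcases hag with hag1 | ⟨g', hg', hag2, hnb'⟩
    · rw [hag1 g hgf]; exact hZd g
    · by_cases hgg : g = g'
      · subst hgg; exact inDiamond_of_nullBelow (hZd g) (hU.2 P hP g) hnb'
      · rw [hag2 g hgf hgg]; exact hZd g
  · -- polluters of the row of `N'`: species (3b) sits on the null segment from `Z f'` up to `N' f'`, species (3d) causally below `N' f'`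
    intro P hP hag hul
    -- the letters of `P` off `f'` are in `◇_h`
    have hoff : ∀ g, g ≠ f' → InDiamond h (P g) := by
      intro g hg
      by_cases hgs : g = σ
      · subst hgs
        exact inDiamond_of_ray_below (hqd g) (hU.2 P hP g) u (by have := hul.1; omega) hul.2
      · rw [hag g hgs hg]; exact hZd g
    have memR : InDiamond h (P f') → P ∈ (diamondRestrict h C).upper := fun hf =>
      mem_diamondRestrict_upper.2 ⟨hP, fun g => if hg : g = f' then hg ▸ hf else hoff g hg⟩
    refine ⟨fun hA3b => ?_, fun hA3d => ?_⟩
    · obtain ⟨hlt, hle, hray⟩ := hA3b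
      -- `N' f' = Z f' + e·n_v` (`q f' = Z f'`), `P f' = Z f' + d·n_v`, `d ≤ e` ⇒ `N' f'` is ray-above `P f'`
      have hqf : q f' = Z f' := c3.1 f' c5
      have hN : N' f' = ray (Z f') v ((N' f').1 - (Z f').1) := by
        have := c6.2.2; rw [hqf] at this; exact this
      have hNP : N' f' = ray (P f') v ((N' f').1 - (P f').1) := ray_between hray hN
      have hf : InDiamond h (P f') := inDiamond_of_ray_below (hN'd f') (hU.2 P hP f') v (by omega) hNP
      exact (c11 P (memR hf) hag hul).1 ⟨hlt, hle, hray⟩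
    · have hf : InDiamond h (P f') := inDiamond_of_effective_below (hN'd f') (hU.2 P hP f') hA3d.1
      exact (c11 P (memR hf) hag hul).2 hA3d

/-! ## §5 The two downward laws packaged -/

/-- **THE DOWNWARD HALF OF LAW 1** (KERNEL, every `h, h'`): RULE D at `N`-cells and `A2I⁻` pass from a configuration in `◇_{h'}` to its
sub-diamond restriction `◇_h`.  (The upward half — RULE D at `P`-cells, `X⁺` — does NOT: the memo's extra partners.) -/
theorem downwardLaws_diamondRestrict {h h' : ℤ} {C : MConfig} (hU : C.InDiamond h') (hS : C.StaticH1) :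
    (∀ Z ∈ (diamondRestrict h C).lower, RuleDMu4N (diamondRestrict h C) Z) ∧ A2IMinusClosed (diamondRestrict h C) :=
  ⟨ruleDMu4N_diamondRestrict_all hU hS.1, a2iMinusClosed_diamondRestrict hU hS.2.2⟩

/-- sanity at the tree's LINE design of height 8: it is its own `◇₈`-restriction (it lies in `◇₈`). -/
theorem diamondRestrict_c8 : diamondRestrict 8 LineDesignCert8.c8 = LineDesignCert8.c8 :=
  diamondRestrict_eq_self LineDesignCert8.c8_inDiamond

/-! ## §6 The mirror: the UPPER restriction `{node ≥ t}` and RULE D at `P`-cells (the `DP` half of LAW 1 under the `+2I` embedding) -/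

/-- **a null step up never lowers the node level** `α − |c|` (any point, any direction). -/
theorem nodeLevel_ray_ge (x : BPoint) (k : Fin 4) {e : ℤ} (he : 0 ≤ e) :
    x.1 - absCharge x ≤ (ray x k e).1 - absCharge (ray x k e) := by
  have hc := chargeOf_ray x k e
  show x.1 - |chargeOf x| ≤ (ray x k e).1 - |chargeOf (ray x k e)|
  rw [ray_fst]
  rcases raySign_cases k with hs | hs
  · rw [hs, mul_one] at hc
    rw [hc]
    rcases abs_cases (chargeOf x + e) with ⟨h1, _⟩ | ⟨h1, _⟩ <;> rcases abs_cases (chargeOf x) with ⟨h2, _⟩ | ⟨h2, _⟩ <;> omega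
  · rw [hs, mul_neg, mul_one, ← sub_eq_add_neg] at hc
    rw [hc]
    rcases abs_cases (chargeOf x - e) with ⟨h1, _⟩ | ⟨h1, _⟩ <;> rcases abs_cases (chargeOf x) with ⟨h2, _⟩ | ⟨h2, _⟩ <;> omega

/-- a node bound survives a null step up. -/
theorem nodeBound_of_ray_up {t : ℤ} {x y : BPoint} (hx : t ≤ x.1 - absCharge x) (k : Fin 4) {e : ℤ} (he : 0 ≤ e)
    (hxy : y = ray x k e) : t ≤ y.1 - absCharge y := by
  have h1 := nodeLevel_ray_ge x k he
  rw [← hxy] at h1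
  omega

/-- a `U`-partner ABOVE a cell with node levels `≥ t` has node levels `≥ t`. -/
theorem nodeBound_of_uPartner_above {t : ℤ} {P N : MCell} (hPt : ∀ f, t ≤ (P f).1 - absCharge (P f)) {σ k : Fin 4}
    (hNP : UPartner N P σ k) : ∀ f, t ≤ (N f).1 - absCharge (N f) := by
  intro f
  by_cases hf : f = σ
  · subst hf
    exact nodeBound_of_ray_up (hPt f) k (by have := hNP.2.1; omega) hNP.2.2
  · rw [← hNP.1 f hf]; exact hPt f

/-- **the UPPER RESTRICTION**: the cells of `C` all of whose letters have node level `α − c ≥ t` (for `C ⊂ ◇_{h+2}` and `t = 2` these are the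
`+2I`-translates of the cells of `◇_h`: the memo's map C). -/
def upperRestrict (t : ℤ) (C : MConfig) : MConfig :=
  ⟨C.lower.filter (fun Z => ∀ f, t ≤ (Z f).1 - absCharge (Z f)), C.upper.filter (fun Z => ∀ f, t ≤ (Z f).1 - absCharge (Z f))⟩

theorem mem_upperRestrict_lower {t : ℤ} {C : MConfig} {Z : MCell} :
    Z ∈ (upperRestrict t C).lower ↔ Z ∈ C.lower ∧ ∀ f, t ≤ (Z f).1 - absCharge (Z f) := Finset.mem_filter

theorem mem_upperRestrict_upper {t : ℤ} {C : MConfig} {Z : MCell} :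
    Z ∈ (upperRestrict t C).upper ↔ Z ∈ C.upper ∧ ∀ f, t ≤ (Z f).1 - absCharge (Z f) := Finset.mem_filter

theorem upperRestrict_inDiamond {t h' : ℤ} {C : MConfig} (hU : C.InDiamond h') : (upperRestrict t C).InDiamond h' :=
  ⟨fun Z hZ => hU.1 Z (mem_upperRestrict_lower.1 hZ).1, fun P hP => hU.2 P (mem_upperRestrict_upper.1 hP).1⟩

/-- the upper restriction of a `G₁`-closed configuration of μ₄ letters is `G₁`-closed. -/
theorem upperRestrict_g1Closed {t h' : ℤ} {C : MConfig} (hU : C.InDiamond h') (hG : C.G1Closed) : (upperRestrict t C).G1Closed := by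
  obtain ⟨hPl, hPu, hDl, hDu⟩ := hG
  refine ⟨fun σ Z hZ => ?_, fun σ P hP => ?_, fun Z hZ => ?_, fun P hP => ?_⟩
  · obtain ⟨hZC, hc⟩ := mem_upperRestrict_lower.1 hZ
    exact mem_upperRestrict_lower.2 ⟨hPl σ Z hZC, fun f => hc (σ f)⟩
  · obtain ⟨hPC, hc⟩ := mem_upperRestrict_upper.1 hP
    exact mem_upperRestrict_upper.2 ⟨hPu σ P hPC, fun f => hc (σ f)⟩
  · obtain ⟨hZC, hc⟩ := mem_upperRestrict_lower.1 hZ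
    refine mem_upperRestrict_lower.2 ⟨hDl Z hZC, fun f => ?_⟩
    show t ≤ (deltaPt (Z f)).1 - absCharge (deltaPt (Z f))
    rw [absCharge_deltaPt (hU.1 Z hZC f).1, deltaPt_fst]; exact hc f
  · obtain ⟨hPC, hc⟩ := mem_upperRestrict_upper.1 hP
    refine mem_upperRestrict_upper.2 ⟨hDu P hPC, fun f => ?_⟩
    show t ≤ (deltaPt (P f)).1 - absCharge (deltaPt (P f))
    rw [absCharge_deltaPt (hU.2 P hPC f).1, deltaPt_fst]; exact hc f

/-- **RULE D at a `P`-cell survives the upper restriction** (KERNEL, every `t`): its servers and covers ABOVE have node levels at least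
those of the head. -/
theorem ruleDMu4P_upperRestrict {t : ℤ} {C : MConfig} {P : MCell} (hPt : ∀ f, t ≤ (P f).1 - absCharge (P f)) (hD : RuleDMu4P C P) :
    RuleDMu4P (upperRestrict t C) P := by
  intro g j hgj k k' hk hk' hne
  have settle : ∀ (f r : Fin 4), MServedAbove C P f r → MServedAbove (upperRestrict t C) P f r := by
    rintro f r ⟨N, hN, hNP⟩
    exact ⟨N, mem_upperRestrict_lower.2 ⟨hN, nodeBound_of_uPartner_above hPt hNP⟩, hNP⟩
  rcases hD g j hgj k k' hk hk' hne with ⟨r, hr, hs⟩ | ⟨r, hr, hs⟩ | ⟨a, b, ha, hb, N, hN, hag, hg1, hg2, hj1, hj2⟩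
  · exact Or.inl ⟨r, hr, settle g r hs⟩
  · exact Or.inr (Or.inl ⟨r, hr, settle j r hs⟩)
  · refine Or.inr (Or.inr ⟨a, b, ha, hb, N, mem_upperRestrict_lower.2 ⟨hN, fun f => ?_⟩, hag, hg1, hg2, hj1, hj2⟩)
    by_cases hfg : f = g
    · subst hfg; exact nodeBound_of_ray_up (hPt f) a (by omega) hg2
    by_cases hfj : f = j
    · subst hfj; exact nodeBound_of_ray_up (hPt f) b (by omega) hj2
    · rw [hag f hfg hfj]; exact hPt f

/-- hence the `P`-half of RULE-D closure of the upper restriction is a THEOREM (the `X⁺` half of LAW 1 under `+2I` is NOT typed here). -/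
theorem ruleDMu4P_upperRestrict_all {t : ℤ} {C : MConfig} (hD : RuleDMu4Closed C) :
    ∀ P ∈ (upperRestrict t C).upper, RuleDMu4P (upperRestrict t C) P := fun P hP =>
  ruleDMu4P_upperRestrict (mem_upperRestrict_upper.1 hP).2 (hD.2 P (mem_upperRestrict_upper.1 hP).1)

/-! ## §7 `X⁺` survives the upper restriction (the `Xp` half of LAW 1 under the `+2I` embedding; KERNEL, every `t`) -/

/-- **node level is monotone along the causal order** of valid letters: `y` causally above `x` has `α − |c|` at least that of `x`. -/
theorem nodeLevel_le_of_effective {x y : BPoint} (hxax : x.2 = (0, 0) ∨ AxisPt x) (hyax : y.2 = (0, 0) ∨ AxisPt y)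
    (hE : Effective (bsub y x)) : x.1 - absCharge x ≤ y.1 - absCharge y := by
  obtain ⟨α, a, b⟩ := x
  obtain ⟨α', a', b'⟩ := y
  simp only [absCharge, chargeOf, AxisPt, Effective, Prod.mk.injEq] at *
  obtain ⟨hD, hsq⟩ := hE
  have h1 : a' - a ≤ α' - α := by nlinarith [sq_nonneg (b' - b), sq_nonneg (a' - a)]
  have h2 : -(a' - a) ≤ α' - α := by nlinarith [sq_nonneg (b' - b), sq_nonneg (a' - a)]
  have h3 : b' - b ≤ α' - α := by nlinarith [sq_nonneg (b' - b), sq_nonneg (a' - a)]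
  have h4 : -(b' - b) ≤ α' - α := by nlinarith [sq_nonneg (b' - b), sq_nonneg (a' - a)]
  simp only [abs_eq_max_neg, max_def] at *
  split_ifs at * <;> omega

/-- dual form: a dual-side letter causally BELOW (`Effective (bsub z p)`) a dual letter whose original has node level `≥ t` has an
original of node level `≥ t` (the original of `p` is causally ABOVE the original of `z`, `bsub_dualPt0`). -/
theorem dual_nodeBound_of_effective {t h' : ℤ} {z p : BPoint} (hz : t ≤ (dualPt 0 z).1 - absCharge (dualPt 0 z))
    (hzD : InDiamond h' (dualPt 0 z)) (hpD : InDiamond h' (dualPt 0 p)) (hE : Effective (bsub z p)) :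
    t ≤ (dualPt 0 p).1 - absCharge (dualPt 0 p) :=
  le_trans hz (nodeLevel_le_of_effective hzD.1 hpD.1 (by rw [bsub_dualPt0]; exact hE))

/-- **`X⁺`-closure survives the upper restriction** (KERNEL, every `t`; the proof of `xPlusClosed_lineRestrict` with «on the ceiling»
replaced by «node level `≥ t`»): in the dual world every breaker ∕ escape cell of an `X` clause — a higher `u`-partner of the head, a
companion between partner and sibling, an (H-e′) or (H-b) participant, a `W_f` leg or (r2a) partner — is letter-wise causally below the
head `Z` or the sibling `n`, i.e. its original is causally ABOVE theirs and inherits the node bound (`nodeLevel_le_of_effective`). -/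
theorem xPlusClosed_upperRestrict {t h' : ℤ} {C : MConfig} (hU : C.InDiamond h') (hX : XPlusClosed C) :
    XPlusClosed (upperRestrict t C) := by
  intro Z hZ q hq n hn σ u w f hF
  have hZ1 := mem_upperRestrict_upper.1 (mem_dual_lower.1 hZ)
  have hq1 := mem_upperRestrict_lower.1 (mem_dual_upper.1 hq)
  have hn1 := mem_upperRestrict_upper.1 (mem_dual_lower.1 hn)
  have hZ0 : Z ∈ (C.dual 0).lower := mem_dual_lower.2 hZ1.1
  have hq0 : q ∈ (C.dual 0).upper := mem_dual_upper.2 hq1.1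
  have hn0 : n ∈ (C.dual 0).lower := mem_dual_lower.2 hn1.1
  have memD : ∀ P ∈ (C.dual 0).upper, (∀ g, t ≤ (dualPt 0 (P g)).1 - absCharge (dualPt 0 (P g))) →
      P ∈ ((upperRestrict t C).dual 0).upper :=
    fun P hP hc => mem_dual_upper.2 (mem_upperRestrict_lower.2 ⟨mem_dual_upper.1 hP, hc⟩)
  have coneZ : ∀ P ∈ (C.dual 0).upper, ∀ g, Effective (bsub (Z g) (P g)) → t ≤ (dualPt 0 (P g)).1 - absCharge (dualPt 0 (P g)) :=
    fun P hP g hE => dual_nodeBound_of_effective (hZ1.2 g) (hU.2 _ hZ1.1 g) (hU.1 _ (mem_dual_upper.1 hP) g) hE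
  have conen : ∀ P ∈ (C.dual 0).upper, ∀ g, Effective (bsub (n g) (P g)) → t ≤ (dualPt 0 (P g)).1 - absCharge (dualPt 0 (P g)) :=
    fun P hP g hE => dual_nodeBound_of_effective (hn1.2 g) (hU.2 _ hn1.1 g) (hU.1 _ (mem_dual_upper.1 hP) g) hE
  obtain ⟨h1, h2, h3, hTop, h5, h6, hNC, hHe, hHb, hWf⟩ := hF
  refine hX Z hZ0 q hq0 n hn0 σ u w f ⟨h1, h2, h3, ?_, h5, h6, ?_, ?_, ?_, ?_⟩
  · -- the escape set: a higher `u`-partner of the head is null-below the head's `σ`-letter (dual coordinates)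
    intro P hP hUP
    refine hTop P (memD P hP fun g => ?_) hUP
    by_cases hg : g = σ
    · rw [hg]
      have he := effective_ray_sub (P σ) u (e := (Z σ).1 - (P σ).1) (by have := hUP.2.1; omega)
      rw [← hUP.2.2] at he
      exact coneZ P hP σ he
    · rw [hUP.1 g hg]; exact hZ1.2 g
  · -- a companion strictly between the partner and the sibling lies on their common null ray below the sibling
    intro P hP hag hlt1 hlt2 heq
    have hc : ∀ g, t ≤ (dualPt 0 (P g)).1 - absCharge (dualPt 0 (P g)) := by
      intro g
      by_cases hg : g = σ
      · rw [hg]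
        have e1 : n σ = ray (P σ) w ((n σ).1 - (P σ).1) := ray_between heq h6.2.2
        have he := effective_ray_sub (P σ) w (e := (n σ).1 - (P σ).1) (by omega)
        rw [← e1] at he
        exact conen P hP σ he
      · rw [hag g hg]; exact hq1.2 g
    exact hNC P (memD P hP hc) hag hlt1 hlt2 heq
  · -- an (H-e′) participant is causally below the sibling
    intro P hP hag hne hEff hnT
    refine hHe P (memD P hP fun g => ?_) hag hne hEff hnT
    by_cases hg : g = σ
    · rw [hg]; exact conen P hP σ hEff
    · rw [hag g hg]; exact hZ1.2 g
  · -- an (H-b) participant: null-below the head on `f`, causally below the sibling on `σ`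
    intro P hP hag2 hNull hEff
    refine hHb P (memD P hP fun g => ?_) hag2 hNull hEff
    by_cases hgs : g = σ
    · rw [hgs]; exact conen P hP σ hEff
    · by_cases hgf : g = f
      · rw [hgf]; exact coneZ P hP f (nullBelow_effective hNull)
      · rw [hag2 g hgs hgf]; exact hZ1.2 g
  · -- a `W_f` leg ∕ (r2a) partner: null-below the head on `f` (and `g`)
    intro P hP hNull
    constructor
    · intro hag
      have hc : ∀ g, t ≤ (dualPt 0 (P g)).1 - absCharge (dualPt 0 (P g)) := fun g => by
        by_cases hgf : g = f
        · rw [hgf]; exact coneZ P hP f (nullBelow_effective hNull)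
        · rw [hag g hgf]; exact hZ1.2 g
      exact (hWf P (memD P hP hc) hNull).1 hag
    · intro g hg hag2 hNull2
      have hc : ∀ g', t ≤ (dualPt 0 (P g')).1 - absCharge (dualPt 0 (P g')) := fun g' => by
        by_cases e1 : g' = f
        · rw [e1]; exact coneZ P hP f (nullBelow_effective hNull)
        · by_cases e2 : g' = g
          · rw [e2]; exact coneZ P hP g (nullBelow_effective hNull2)
          · rw [hag2 g' e1 e2]; exact hZ1.2 g'
      exact (hWf P (memD P hP hc) hNull).2 g hg hag2 hNull2

/-- **the UPWARD laws restrict verbatim UPWARD** (the `DP` and `Xp` halves of LAW 1 under the census's map C, for every height): RULE D at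
`P`-cells and `X⁺`-closedness of a static `◇_{h'}`-configuration pass to its upper restriction `{node ≥ t}`. (RULE D at `N`-cells and
`A2I⁻` do NOT — their partners may lie below level `t`: the memo's `DN`∕`Am` SUPER clauses under C.) -/
theorem upwardLaws_upperRestrict {t h' : ℤ} {C : MConfig} (hU : C.InDiamond h') (hS : C.StaticH1) :
    (∀ P ∈ (upperRestrict t C).upper, RuleDMu4P (upperRestrict t C) P) ∧ XPlusClosed (upperRestrict t C) :=
  ⟨ruleDMu4P_upperRestrict_all hS.1, xPlusClosed_upperRestrict hU hS.2.1⟩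

end Summit.HodgeConjecture.HodgeConjecture.Cruxes.BlochSeedDiscOne.DiamondRestrict
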